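import Literature.NumberTheory.EllipticCurves.BSDSelmerSmithProofs
import HarnessLib

/-!
# bsd.S34 (Smith, arXiv:2503.17619): density bookkeeping for `smith_selmerCorank_density`

`Literature.NumberTheory.EllipticCurves.smith_selmerCorank_density W` (file `BSDSelmer`, bsd.S34)
transcribes A. Smith, *The Birch and Swinnerton-Dyer conjecture implies Goldfeld's conjecture*,
arXiv:2503.17619 (2025), **Theorem 1.1**: for every elliptic curve `E/ℚ` the `2^∞`-Selmer corank
of the quadratic twist `E^d` is `0` for density `1/2` of the twists, `1` for density `1/2`, and any
fixed `r ≥ 2` for density `0`. The Lean statement is the conjunction of these three clauses for the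
natural density `twistDensity` over squarefree `d` ordered by `|d|`.

This file does **not** discharge the fact: the printed proof (op. cit., §§2–6, resting on Smith,
arXiv:2207.05674 and arXiv:2207.05143, for curves without a balanced isogeny, and on the isogeny
trick Prop. 1.18, the modified higher-Selmer machinery Thm. 2.4 and the moment method of §§4–5 for
the balanced cases) is a theory of its own, none of which is in Mathlib or in this tree. What is
recorded here, next to the monotonicity/additivity lemmas `twistDensity_one_mono`,
`twistDensity_or_of_disjoint` of `BSDSelmerSmithProofs` (which reduce Cor. 1.3 to Thm. 1.1), is
the remaining elementary bookkeeping of natural densities over squarefree integers that the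
statement of Thm. 1.1 is built from, all proved:

* `twistDensity_congr`, `twistDensity_unique`, `twistDensity.nonneg`, `twistDensity.le_one`,
  `twistDensity_true`, `twistDensity_one_of_forall`, `twistDensity_zero_of_forall_not` —
  densities only see squarefree `d`, are well-defined numbers in `[0, 1]`, and the whole family
  has density `1`;
* `twistDensity.compl`, `twistDensity.add`, `twistDensity.mono_zero`,
  `twistDensity_zero_of_disjoint` — complements, disjoint unions (disjointness required on
  squarefree `d` only), subsets of null sets, and: two disjoint sets of densities `δ₀ + δ₁ = 1`
  leave density `0` for anything disjoint from both;
* `smith_selmerCorank_density_iff` — consequently the third clause of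
  `smith_selmerCorank_density` (each corank `r ≥ 2` has density `0`) is a formal consequence of
  the first two (coranks `0` and `1` each have density `1/2`), exactly as in the source, where the
  case `r ≥ 2` of Thm. 1.1 is the complement of the cases `r = 0, 1`;
* `not_smith_selmerCorank_density_cusp` — a scope remark: the declared constant
  `smith_selmerCorank_density : WeierstrassCurve ℚ → Prop` carries no ellipticity binder (the
  section's `[W.IsElliptic]` is unused in the body and therefore omitted by Lean), and the
  predicate fails for the cuspidal cubic `y² = x³`; the faithful closed reading of Smith's
  theorem is `∀ (W : WeierstrassCurve ℚ) [W.IsElliptic], smith_selmerCorank_density W`;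
* `smith_selmerCorank_density_iff_le_one_and_even` — **the two inputs of Thm. 1.1 separated**:
  the fact is equivalent to the conjunction of (a) "`r_{2^∞}(E^d) ≤ 1` for `100 %` of the
  twists" (the part of Thm. 1.1 that rests on Smith's higher `2^k`-Selmer theory,
  arXiv:2207.05674 / arXiv:2207.05143 and §§2–6 of the paper) and (b) "`r_{2^∞}(E^d)` is even for
  `50 %` of the twists" (parity equidistribution); `twistDensity.and_one`,
  `twistDensity_even_selmerCorankTwoInfty_of`, `smith_selmerCorank_density_of_le_one_of_even`
  are the two directions;
* `smith_selmerCorank_density_iff_le_one_and_rootNumber` — for an elliptic `W`, given the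
  `2`-parity theorem `(-1)^{r_{2^∞}(E')} = w(E')` for all elliptic `E'/ℚ` (display (1.2) of the
  paper, "[Monsky96]"; the bsd.S19 fact `p_parity E' 2`), input (b) becomes the statement that
  the root number `w(E^d)` is `+1` for `50 %` of the squarefree `d`, i.e. root-number
  equidistribution in the quadratic twist family, both signs of `d` counted
  (`twistDensity_even_selmerCorankTwoInfty_iff_rootNumber`); the variant
  `…_of_exists_isNewformOf` takes `2`-parity from Monsky's congruence and the Modularity Theorem
  as in `BSDSelmerSmithProofs`. In particular Thm. 1.1 and `2`-parity imply root-number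
  equidistribution in the quadratic twist family (`twistDensity_rootNumber_quadraticTwist_of`);
* `smith_analyticRank_density_of_BSDRankFormula` — **Cor. 1.2 deduced as printed** ("if the BSD
  conjecture is true in the quadratic twist family of `E`, then Goldfeld's conjecture holds for
  `E`"): from Thm. 1.1 for `W`, the rank part of BSD for every twist `E^d`
  (`WeierstrassCurve.BSDRankFormula`) and display (1.2) in Monsky's form
  (`monsky_selmerCorank_two_mod_two_eq`), the analytic rank of `E^d` is `0` resp. `1` for density
  `1/2` each and `r ≥ 2` for density `0` (Goldfeld's conjecture for `E`, in the `twistDensity`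
  convention); the pointwise step is
  `analyticRank_quadraticTwist_eq_selmerCorankTwoInfty_of_le_one` and the transfer along the
  density-`1` set is `twistDensity_congr_of_one`.

Only theorems are added; no definition and no statement of `BSDSelmer` is changed.

## References

* [arXiv250317619] A. Smith, *The Birch and Swinnerton-Dyer conjecture implies Goldfeld's
  conjecture*, arXiv:2503.17619 (2025): Thm. 1.1, displays (1.1)–(1.2), Cor. 1.2 (with its
  proof), Cor. 1.3, §1.2 (Prop. 1.18), §1.3 (outline).
* [Gold79] D. Goldfeld, *Conjectures on elliptic curves over quadratic fields*, Number theory,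
  Carbondale 1979, LNM 751, Springer (1979), 108–118 (Smith's reference for the conjecture).
* [DokchitserDokchitserAnnals2010] T. Dokchitser, V. Dokchitser, *On the Birch–Swinnerton-Dyer
  quotients modulo squares*, Ann. of Math. 172 (2010), Thm. 1.4 (case `p = 2`: Monsky 1996).
* [Monsky1996] P. Monsky, *Generalizing the Birch–Stephens theorem. I. Modular curves*, Math. Z.
  221 (1996), 415–420.
* [BCDTJAMS2001] C. Breuil, B. Conrad, F. Diamond, R. Taylor, J. Amer. Math. Soc. 14 (2001), Thm. A.
-/

noncomputable section

open scoped Classical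
open Filter Topology

namespace Literature.NumberTheory.EllipticCurves

section TwistDensity

variable {P Q P₀ P₁ : ℤ → Prop} {δ δ' δ₀ δ₁ : ℝ}

/-- For `X ≥ 1` the full window `{d squarefree, |d| ≤ X}` is nonempty (`d = 1`), so its
cardinality is positive and the density quotient is a genuine quotient. [folklore] -/
theorem ncard_setOf_squarefree_abs_le_pos {X : ℕ} (hX : 1 ≤ X) :
    0 < {d : ℤ | Squarefree d ∧ |d| ≤ (X : ℤ)}.ncard :=
  (Set.ncard_pos (finite_setOf_squarefree_abs_le' X)).2
    ⟨1, squarefree_one, by rw [abs_one]; exact_mod_cast hX⟩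

/-- A window count is at most the full window count. [folklore] -/
theorem ncard_setOf_squarefree_abs_le_le (P : ℤ → Prop) (X : ℕ) :
    {d : ℤ | Squarefree d ∧ |d| ≤ (X : ℤ) ∧ P d}.ncard ≤
      {d : ℤ | Squarefree d ∧ |d| ≤ (X : ℤ)}.ncard :=
  Set.ncard_le_ncard (fun _ hd ↦ ⟨hd.1, hd.2.1⟩) (finite_setOf_squarefree_abs_le' X)

/-- Window counts are monotone in the predicate (on squarefree integers). [folklore] -/
theorem ncard_setOf_squarefree_abs_le_mono (hQP : ∀ d, Squarefree d → Q d → P d) (X : ℕ) :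
    {d : ℤ | Squarefree d ∧ |d| ≤ (X : ℤ) ∧ Q d}.ncard ≤
      {d : ℤ | Squarefree d ∧ |d| ≤ (X : ℤ) ∧ P d}.ncard :=
  Set.ncard_le_ncard (fun d hd ↦ ⟨hd.1, hd.2.1, hQP d hd.1 hd.2.2⟩)
    (finite_setOf_squarefree_abs_le X P)

/-- The window counts of `P` and of `¬ P` add up to the full window count. [folklore] -/
theorem ncard_setOf_squarefree_abs_le_add_not (P : ℤ → Prop) (X : ℕ) :
    {d : ℤ | Squarefree d ∧ |d| ≤ (X : ℤ) ∧ P d}.ncard +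
        {d : ℤ | Squarefree d ∧ |d| ≤ (X : ℤ) ∧ ¬ P d}.ncard =
      {d : ℤ | Squarefree d ∧ |d| ≤ (X : ℤ)}.ncard := by
  have hdisj : Disjoint {d : ℤ | Squarefree d ∧ |d| ≤ (X : ℤ) ∧ P d}
      {d : ℤ | Squarefree d ∧ |d| ≤ (X : ℤ) ∧ ¬ P d} :=
    Set.disjoint_left.2 fun _ h₁ h₂ ↦ h₂.2.2 h₁.2.2
  rw [← Set.ncard_union_eq hdisj (finite_setOf_squarefree_abs_le X P)
    (finite_setOf_squarefree_abs_le X _)]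
  congr 1
  ext d
  simp only [Set.mem_union, Set.mem_setOf_eq]
  tauto

/-- `twistDensity` only depends on the predicate restricted to squarefree integers. [folklore] -/
theorem twistDensity_congr (h : ∀ d, Squarefree d → (P d ↔ Q d)) (δ : ℝ) :
    twistDensity P δ ↔ twistDensity Q δ := by
  have hset : ∀ X : ℕ, {d : ℤ | Squarefree d ∧ |d| ≤ (X : ℤ) ∧ P d} =
      {d : ℤ | Squarefree d ∧ |d| ≤ (X : ℤ) ∧ Q d} := fun X ↦ by
    ext d
    simp only [Set.mem_setOf_eq]
    exact ⟨fun hd ↦ ⟨hd.1, hd.2.1, (h d hd.1).1 hd.2.2⟩,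
      fun hd ↦ ⟨hd.1, hd.2.1, (h d hd.1).2 hd.2.2⟩⟩
  simp only [twistDensity, hset]

/-- A set of squarefree integers has at most one natural density. [folklore] -/
theorem twistDensity_unique (h : twistDensity P δ) (h' : twistDensity P δ') : δ = δ' :=
  tendsto_nhds_unique h h'

/-- Natural densities are nonnegative. [folklore] -/
theorem twistDensity.nonneg (h : twistDensity P δ) : 0 ≤ δ :=
  ge_of_tendsto' h fun _ ↦ div_nonneg (Nat.cast_nonneg _) (Nat.cast_nonneg _)

/-- Natural densities are at most `1`. [folklore] -/
theorem twistDensity.le_one (h : twistDensity P δ) : δ ≤ 1 := by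
  refine le_of_tendsto' h fun X ↦ div_le_one_of_le₀ ?_ (Nat.cast_nonneg _)
  rw [Nat.card_coe_set_eq, Nat.card_coe_set_eq]
  exact_mod_cast ncard_setOf_squarefree_abs_le_le P X

/-- The family of all squarefree integers has density `1`. [folklore] -/
theorem twistDensity_true : twistDensity (fun _ ↦ True) 1 := by
  refine tendsto_const_nhds.congr' (eventually_atTop.2 ⟨1, fun X hX ↦ ?_⟩)
  have hset : {d : ℤ | Squarefree d ∧ |d| ≤ (X : ℤ) ∧ True} =
      {d : ℤ | Squarefree d ∧ |d| ≤ (X : ℤ)} := by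
    ext d
    simp only [Set.mem_setOf_eq, and_true]
  have hpos : (0 : ℝ) < {d : ℤ | Squarefree d ∧ |d| ≤ (X : ℤ)}.ncard := by
    exact_mod_cast ncard_setOf_squarefree_abs_le_pos hX
  simp only [Nat.card_coe_set_eq]
  rw [hset, div_self hpos.ne']

/-- Everywhere-true predicates (on squarefree integers) have density `1`. [folklore] -/
theorem twistDensity_one_of_forall (h : ∀ d, Squarefree d → P d) : twistDensity P 1 :=
  (twistDensity_congr (Q := fun _ ↦ True) (fun d hd ↦ iff_true_intro (h d hd)) 1).2
    twistDensity_true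

/-- Complements: if `P` has density `δ` then `¬ P` has density `1 - δ`. [folklore] -/
theorem twistDensity.compl (h : twistDensity P δ) : twistDensity (fun d ↦ ¬ P d) (1 - δ) := by
  refine ((tendsto_const_nhds (x := (1 : ℝ))).sub h).congr'
    (eventually_atTop.2 ⟨1, fun X hX ↦ ?_⟩)
  have hpos : (0 : ℝ) < {d : ℤ | Squarefree d ∧ |d| ≤ (X : ℤ)}.ncard := by
    exact_mod_cast ncard_setOf_squarefree_abs_le_pos hX
  have hsum : ({d : ℤ | Squarefree d ∧ |d| ≤ (X : ℤ) ∧ P d}.ncard : ℝ) +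
      {d : ℤ | Squarefree d ∧ |d| ≤ (X : ℤ) ∧ ¬ P d}.ncard =
        {d : ℤ | Squarefree d ∧ |d| ≤ (X : ℤ)}.ncard := by
    exact_mod_cast ncard_setOf_squarefree_abs_le_add_not P X
  simp only [Nat.card_coe_set_eq]
  rw [eq_div_iff hpos.ne', sub_mul, div_mul_cancel₀ _ hpos.ne', one_mul]
  linarith

/-- Disjoint unions: if `P`, `Q` are disjoint on squarefree integers with densities `δ`, `δ'`,
then `P ∨ Q` has density `δ + δ'` (`twistDensity_or_of_disjoint` of `BSDSelmerSmithProofs`,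
applied to `Squarefree d ∧ P d` and `Squarefree d ∧ Q d`). [folklore] -/
theorem twistDensity.add (hP : twistDensity P δ) (hQ : twistDensity Q δ')
    (hPQ : ∀ d, Squarefree d → P d → ¬ Q d) :
    twistDensity (fun d ↦ P d ∨ Q d) (δ + δ') := by
  have hP' : twistDensity (fun d ↦ Squarefree d ∧ P d) δ :=
    (twistDensity_congr (fun d hd ↦ (and_iff_right hd).symm) δ).1 hP
  have hQ' : twistDensity (fun d ↦ Squarefree d ∧ Q d) δ' :=
    (twistDensity_congr (fun d hd ↦ (and_iff_right hd).symm) δ').1 hQ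
  refine (twistDensity_congr (fun d hd ↦ ?_) _).1
    (twistDensity_or_of_disjoint (fun d hp hq ↦ hPQ d hp.1 hp.2 hq.2) hP' hQ')
  simp only [hd, true_and]

/-- Subsets of density-zero sets have density zero. [folklore] -/
theorem twistDensity.mono_zero (h : twistDensity P 0) (hQP : ∀ d, Squarefree d → Q d → P d) :
    twistDensity Q 0 := by
  refine squeeze_zero (fun X ↦ div_nonneg (Nat.cast_nonneg _) (Nat.cast_nonneg _))
    (fun X ↦ ?_) h
  simp only [Nat.card_coe_set_eq]
  exact div_le_div_of_nonneg_right (by exact_mod_cast ncard_setOf_squarefree_abs_le_mono hQP X)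
    (Nat.cast_nonneg _)

/-- Everywhere-false predicates (on squarefree integers) have density `0`. [folklore] -/
theorem twistDensity_zero_of_forall_not (h : ∀ d, Squarefree d → ¬ P d) : twistDensity P 0 := by
  have h0 : twistDensity (fun _ ↦ ¬ True) 0 := by simpa using twistDensity_true.compl
  exact h0.mono_zero fun d hd hP ↦ (h d hd hP).elim

/-- If two predicates, disjoint on squarefree integers, have densities `δ₀ + δ₁ = 1`, then every
predicate disjoint from both has density `0`. [folklore] -/
theorem twistDensity_zero_of_disjoint (h₀ : twistDensity P₀ δ₀) (h₁ : twistDensity P₁ δ₁)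
    (hδ : δ₀ + δ₁ = 1) (h₀₁ : ∀ d, Squarefree d → P₀ d → ¬ P₁ d)
    (hQ₀ : ∀ d, Squarefree d → Q d → ¬ P₀ d) (hQ₁ : ∀ d, Squarefree d → Q d → ¬ P₁ d) :
    twistDensity Q 0 := by
  have hor : twistDensity (fun d ↦ P₀ d ∨ P₁ d) 1 := hδ ▸ h₀.add h₁ h₀₁
  have hc : twistDensity (fun d ↦ ¬ (P₀ d ∨ P₁ d)) 0 := by simpa using hor.compl
  exact hc.mono_zero fun d hd hq ↦ not_or.2 ⟨hQ₀ d hd hq, hQ₁ d hd hq⟩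

end TwistDensity

/-! ## bsd.S34: the clause `r ≥ 2` of Smith's Theorem 1.1 is the complement of `r = 0, 1` -/

section S34

variable (W : WeierstrassCurve ℚ)

/-- **bsd.S34, structure of the statement** (A. Smith, arXiv:2503.17619, Thm. 1.1). The Lean
transcription `smith_selmerCorank_density W` is equivalent to its first two clauses: if the
quadratic twists `E^d` with `2^∞`-Selmer corank `0` and those with corank `1` each have density
`1/2` among squarefree `d`, then for every `r ≥ 2` the twists with corank exactly `r` have
density `0` (the three predicates are pairwise disjoint and `1/2 + 1/2 = 1`;
`twistDensity_zero_of_disjoint`). This is the bookkeeping step of the source, where the case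
`r ≥ 2` of Thm. 1.1 is the complement of the cases `r = 0` and `r = 1`; the substance of
Thm. 1.1 (the two densities `1/2`) is not proved here. [cite: arXiv250317619, Thm. 1.1] -/
theorem smith_selmerCorank_density_iff :
    smith_selmerCorank_density W ↔
      twistDensity (fun d ↦ d ≠ 0 ∧ selmerCorankTwoInfty (W.quadraticTwist d) = 0) (1 / 2) ∧
        twistDensity (fun d ↦ d ≠ 0 ∧ selmerCorankTwoInfty (W.quadraticTwist d) = 1) (1 / 2) := by
  refine ⟨fun h ↦ ⟨h.1, h.2.1⟩, fun h ↦ ⟨h.1, h.2, fun r hr ↦ ?_⟩⟩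
  refine twistDensity_zero_of_disjoint h.1 h.2 (by norm_num) (fun d _ h₀ h₁ ↦ ?_)
    (fun d _ hq h₀ ↦ ?_) (fun d _ hq h₁ ↦ ?_)
  · exact absurd (h₀.2.symm.trans h₁.2) (by norm_num)
  · have := hq.2.symm.trans h₀.2
    omega
  · have := hq.2.symm.trans h₁.2
    omega

/-- **bsd.S34, reduction** (A. Smith, arXiv:2503.17619, Thm. 1.1): the named fact
`smith_selmerCorank_density W` follows from the two density-`1/2` clauses alone.
[cite: arXiv250317619, Thm. 1.1] -/
theorem smith_selmerCorank_density_of_half_half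
    (h₀ : twistDensity (fun d ↦ d ≠ 0 ∧ selmerCorankTwoInfty (W.quadraticTwist d) = 0) (1 / 2))
    (h₁ : twistDensity (fun d ↦ d ≠ 0 ∧ selmerCorankTwoInfty (W.quadraticTwist d) = 1) (1 / 2)) :
    smith_selmerCorank_density W :=
  (smith_selmerCorank_density_iff W).2 ⟨h₀, h₁⟩

/-! ### Scope of the named fact: ellipticity is not among its binders

In `BSDSelmer` the fact is declared under `variable (W : WeierstrassCurve ℚ) [W.IsElliptic]`, but
the instance is not used in the body, so Lean omits it: the declared constant is
`smith_selmerCorank_density : WeierstrassCurve ℚ → Prop`, a predicate on *all* Weierstrass cubics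
over `ℚ`. Smith's Theorem 1.1 concerns elliptic curves; for singular cubics the predicate is junk
and can fail, as the next two theorems record for the cuspidal cubic `y² = x³` (all of whose
"quadratic twists" are `y² = x³` itself, so the corank predicate does not depend on `d` and no
clause of density `1/2` can hold). Consequently the literal universal closure
`∀ W, smith_selmerCorank_density W` is false, and a discharge must carry `[W.IsElliptic]`, i.e.
prove `∀ (W : WeierstrassCurve ℚ) [W.IsElliptic], smith_selmerCorank_density W` — the faithful
reading of the source. -/

/-- The "quadratic twists" of the cuspidal cubic `y² = x³` (`a₁ = ⋯ = a₆ = 0`, so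
`b₂ = b₄ = b₆ = 0`) are all equal to it: `W^d = W` for every `d`. [folklore] -/
theorem quadraticTwist_cusp (d : ℚ) :
    (⟨0, 0, 0, 0, 0⟩ : WeierstrassCurve ℚ).quadraticTwist d = ⟨0, 0, 0, 0, 0⟩ := by
  ext <;> simp [WeierstrassCurve.quadraticTwist, WeierstrassCurve.b₂, WeierstrassCurve.b₄,
    WeierstrassCurve.b₆]

/-- **Scope remark, proved.** The predicate `smith_selmerCorank_density` fails for the (singular)
cuspidal cubic `y² = x³` over `ℚ`: its twists all coincide (`quadraticTwist_cusp`), so the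
`2^∞`-Selmer-corank predicate is independent of `d` and has density `0` or `1`, never `1/2`
(`twistDensity_unique`). Hence `∀ W, smith_selmerCorank_density W` is false as stated, while
Smith's Theorem 1.1 (arXiv:2503.17619), which is about *elliptic* curves, is untouched: the
faithful closed form of the fact is `∀ (W : WeierstrassCurve ℚ) [W.IsElliptic],
smith_selmerCorank_density W`. [folklore] -/
theorem not_smith_selmerCorank_density_cusp :
    ¬ smith_selmerCorank_density (⟨0, 0, 0, 0, 0⟩ : WeierstrassCurve ℚ) := by
  intro h
  by_cases hc : selmerCorankTwoInfty (⟨0, 0, 0, 0, 0⟩ : WeierstrassCurve ℚ) = 0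
  · have h1 : twistDensity (fun d ↦ d ≠ 0 ∧ selmerCorankTwoInfty
        ((⟨0, 0, 0, 0, 0⟩ : WeierstrassCurve ℚ).quadraticTwist d) = 0) 1 :=
      twistDensity_one_of_forall fun d hd ↦ ⟨hd.ne_zero, by rwa [quadraticTwist_cusp]⟩
    have := twistDensity_unique h.1 h1
    norm_num at this
  · have h0 : twistDensity (fun d ↦ d ≠ 0 ∧ selmerCorankTwoInfty
        ((⟨0, 0, 0, 0, 0⟩ : WeierstrassCurve ℚ).quadraticTwist d) = 0) 0 :=
      twistDensity_zero_of_forall_not fun d _ hd ↦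
        hc (by rw [← quadraticTwist_cusp (d : ℚ)]; exact hd.2)
    have := twistDensity_unique h.1 h0
    norm_num at this

end S34

/-! ## bsd.S34: Theorem 1.1 = "`r_{2^∞}(E^d) ≤ 1` for `100 %`" + "parity equidistributed"

Smith's Theorem 1.1 has two inputs of a different nature, which the statement
`smith_selmerCorank_density W` fuses: that `100 %` of the quadratic twists have `2^∞`-Selmer
corank `≤ 1` (the content of the higher-Selmer machinery), and that the corank is even for exactly
half of the twists (parity). The theorems below separate them — the fact is *equivalent* to the
conjunction of the two density statements — and, for an elliptic `W` and granted the
`2`-parity theorem (display (1.2) of the paper), identify the parity input with the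
equidistribution of the root number `w(E^d)` over squarefree `d`. Nothing here proves either
input. -/

section S34Parity

variable {P Q R : ℤ → Prop} {δ : ℝ}

/-- Intersecting with a set of density `1` does not change the density: if `P` has density `δ`
and `R` has density `1` (over squarefree integers), then `P ∧ R` has density `δ`
(`P ∧ ¬ R` lies in the null set `¬ R`, and `P ∧ R` is the complement of the disjoint union
`¬ P ∨ (P ∧ ¬ R)` of density `(1 - δ) + 0`). [folklore] -/
theorem twistDensity.and_one (hP : twistDensity P δ) (hR : twistDensity R 1) :
    twistDensity (fun d ↦ P d ∧ R d) δ := by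
  have hnR : twistDensity (fun d ↦ ¬ R d) 0 := by simpa using hR.compl
  have hPnR : twistDensity (fun d ↦ P d ∧ ¬ R d) 0 := hnR.mono_zero fun _ _ h ↦ h.2
  have hU := hP.compl.add hPnR fun _ _ h h' ↦ h h'.1
  rw [add_zero] at hU
  have hC := hU.compl
  rw [sub_sub_cancel] at hC
  exact (twistDensity_congr (fun d _ ↦ by tauto) δ).1 hC

/-- Predicates that agree on a set of density `1` have the same densities (one direction):
if `R` has density `1`, `P ↔ Q` on squarefree `d` with `R d`, and `P` has density `δ`, then `Q`
has density `δ` (`Q` is the disjoint union of `Q ∧ R = P ∧ R`, of density `δ` by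
`twistDensity.and_one`, and of `Q ∧ ¬ R`, of density `0`). [folklore] -/
theorem twistDensity.of_congr_one (hP : twistDensity P δ) (hR : twistDensity R 1)
    (h : ∀ d, Squarefree d → R d → (P d ↔ Q d)) : twistDensity Q δ := by
  have h1 : twistDensity (fun d ↦ Q d ∧ R d) δ :=
    (twistDensity_congr (fun d hd ↦ and_congr_left fun hRd ↦ h d hd hRd) δ).1 (hP.and_one hR)
  have hnR : twistDensity (fun d ↦ ¬ R d) 0 := by simpa using hR.compl
  have h2 : twistDensity (fun d ↦ Q d ∧ ¬ R d) 0 := hnR.mono_zero fun _ _ h ↦ h.2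
  have h3 := h1.add h2 fun _ _ h h' ↦ h'.2 h.2
  rw [add_zero] at h3
  exact (twistDensity_congr (fun d _ ↦ by tauto) δ).1 h3

/-- **Predicates that agree on a set of density `1` have the same densities.** If `R` has
density `1` over squarefree integers and `P d ↔ Q d` for every squarefree `d` with `R d`, then
`P` has density `δ` iff `Q` has density `δ`. This is the form in which "`100 %` of the twists
satisfy `R`" is used in Smith, arXiv:2503.17619, §1 (proofs of Cor. 1.2 and Cor. 1.3). [folklore] -/
theorem twistDensity_congr_of_one (hR : twistDensity R 1)
    (h : ∀ d, Squarefree d → R d → (P d ↔ Q d)) : twistDensity P δ ↔ twistDensity Q δ :=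
  ⟨fun hP ↦ hP.of_congr_one hR h, fun hQ ↦ hQ.of_congr_one hR fun d hd hRd ↦ (h d hd hRd).symm⟩

variable (W : WeierstrassCurve ℚ)

/-- **Thm. 1.1 ⇒ the parity of `r_{2^∞}(E^d)` is equidistributed** (A. Smith, arXiv:2503.17619,
Thm. 1.1, read off): the squarefree `d` for which the `2^∞`-Selmer corank of `E^d` is even have
density `1/2`. Indeed they are the disjoint union of `{r_{2^∞}(E^d) = 0}` (density `1/2`) and of
the even coranks `≥ 2`, a set disjoint from `{r = 0}` and `{r = 1}` and hence of density `0`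
(`twistDensity_zero_of_disjoint`). [cite: arXiv250317619, Thm. 1.1] -/
theorem twistDensity_even_selmerCorankTwoInfty_of (hS : smith_selmerCorank_density W) :
    twistDensity (fun d ↦ d ≠ 0 ∧ Even (selmerCorankTwoInfty (W.quadraticTwist d))) (1 / 2) := by
  obtain ⟨h0, h1, -⟩ := hS
  have hQ : twistDensity (fun d ↦ d ≠ 0 ∧ Even (selmerCorankTwoInfty (W.quadraticTwist d)) ∧
      selmerCorankTwoInfty (W.quadraticTwist d) ≠ 0) 0 := by
    refine twistDensity_zero_of_disjoint h0 h1 (add_halves 1)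
      (fun d _ hd0 hd1 ↦ absurd (hd0.2.symm.trans hd1.2) zero_ne_one)
      (fun d _ hq hd0 ↦ hq.2.2 hd0.2) (fun d _ hq hd1 ↦ ?_)
    obtain ⟨-, hc, -⟩ := hq
    rw [hd1.2] at hc
    exact Nat.not_even_one hc
  have h := h0.add hQ fun d _ hd0 hq ↦ hq.2.2 hd0.2
  rw [add_zero] at h
  refine (twistDensity_congr (fun d _ ↦ ⟨?_, fun hd ↦ ?_⟩) _).1 h
  · rintro (⟨hd, hc⟩ | ⟨hd, hc, -⟩)
    · exact ⟨hd, by rw [hc]; exact Even.zero⟩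
    · exact ⟨hd, hc⟩
  · by_cases hc : selmerCorankTwoInfty (W.quadraticTwist d) = 0
    · exact Or.inl ⟨hd.1, hc⟩
    · exact Or.inr ⟨hd.1, hd.2, hc⟩

/-- **The two inputs of Thm. 1.1 suffice** (A. Smith, arXiv:2503.17619, structure of Thm. 1.1):
if the quadratic twists with `r_{2^∞}(E^d) ≤ 1` have density `1` and those with `r_{2^∞}(E^d)`
even have density `1/2`, then `smith_selmerCorank_density W`. For `{r = 0}` is
`{r even} ∩ {r ≤ 1}`, of density `1/2` (`twistDensity.and_one`), and `{r = 1}` is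
`{r odd} ∩ {r ≤ 1}`, of density `1 - 1/2 = 1/2`; conclude by
`smith_selmerCorank_density_of_half_half`. [cite: arXiv250317619, Thm. 1.1] -/
theorem smith_selmerCorank_density_of_le_one_of_even
    (h₁ : twistDensity (fun d ↦ d ≠ 0 ∧ selmerCorankTwoInfty (W.quadraticTwist d) ≤ 1) 1)
    (h₂ : twistDensity
      (fun d ↦ d ≠ 0 ∧ Even (selmerCorankTwoInfty (W.quadraticTwist d))) (1 / 2)) :
    smith_selmerCorank_density W := by
  have he : twistDensity
      (fun d ↦ d ≠ 0 ∧ selmerCorankTwoInfty (W.quadraticTwist d) = 0) (1 / 2) := by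
    refine (twistDensity_congr (fun d _ ↦ ⟨?_, ?_⟩) _).1 (h₂.and_one h₁)
    · rintro ⟨⟨hd, hc⟩, -, hc1⟩
      refine ⟨hd, ?_⟩
      rcases Nat.le_one_iff_eq_zero_or_eq_one.1 hc1 with h | h
      · exact h
      · rw [h] at hc
        exact absurd hc Nat.not_even_one
    · rintro ⟨hd, hc⟩
      exact ⟨⟨hd, by rw [hc]; exact Even.zero⟩, hd, by rw [hc]; exact Nat.zero_le 1⟩
  have ho : twistDensity
      (fun d ↦ d ≠ 0 ∧ selmerCorankTwoInfty (W.quadraticTwist d) = 1) (1 / 2) := by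
    have hc := h₂.compl
    rw [sub_half] at hc
    refine (twistDensity_congr (fun d _ ↦ ⟨?_, ?_⟩) _).1 (hc.and_one h₁)
    · rintro ⟨hne, hd, hc1⟩
      refine ⟨hd, ?_⟩
      rcases Nat.le_one_iff_eq_zero_or_eq_one.1 hc1 with h | h
      · exact absurd ⟨hd, by rw [h]; exact Even.zero⟩ hne
      · exact h
    · rintro ⟨hd, hc1⟩
      refine ⟨fun h ↦ ?_, hd, hc1.le⟩
      obtain ⟨-, he⟩ := h
      rw [hc1] at he
      exact Nat.not_even_one he
  exact smith_selmerCorank_density_of_half_half W he ho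

/-- **bsd.S34, the two inputs of Thm. 1.1 separated** (A. Smith, arXiv:2503.17619, Thm. 1.1):
`smith_selmerCorank_density W` holds if and only if (a) the quadratic twists `E^d` with
`2^∞`-Selmer corank `≤ 1` have density `1` among squarefree `d` **and** (b) those with even
`2^∞`-Selmer corank have density `1/2`. Direction `→` is
`twistDensity_selmerCorankTwoInfty_le_one_of` (`BSDSelmerSmithProofs`) and
`twistDensity_even_selmerCorankTwoInfty_of`; direction `←` is
`smith_selmerCorank_density_of_le_one_of_even`. The source proves both at once (the corank
distribution of §§2–6 and of Smith, arXiv:2207.05674, arXiv:2207.05143, has the parity built in);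
the separation is bookkeeping that isolates (a), the part only the higher `2^k`-Selmer theory
delivers, from (b), which `2`-parity turns into a statement about root numbers
(`smith_selmerCorank_density_iff_le_one_and_rootNumber`). [cite: arXiv250317619, Thm. 1.1] -/
theorem smith_selmerCorank_density_iff_le_one_and_even :
    smith_selmerCorank_density W ↔
      twistDensity (fun d ↦ d ≠ 0 ∧ selmerCorankTwoInfty (W.quadraticTwist d) ≤ 1) 1 ∧
        twistDensity
          (fun d ↦ d ≠ 0 ∧ Even (selmerCorankTwoInfty (W.quadraticTwist d))) (1 / 2) :=
  ⟨fun h ↦ ⟨twistDensity_selmerCorankTwoInfty_le_one_of W h,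
      twistDensity_even_selmerCorankTwoInfty_of W h⟩,
    fun h ↦ smith_selmerCorank_density_of_le_one_of_even W h.1 h.2⟩

variable [W.IsElliptic]

/-- **Display (1.2) of Smith, §1, applied to a twist**: granted the `2`-parity theorem
`(-1)^{corank_{ℤ_2} Sel_{2^∞}(E'/ℚ)} = w(E')` for every elliptic `E'/ℚ` (`hpar`, the bsd.S19 fact
`p_parity E' 2`; Dokchitser–Dokchitser 2010, Thm. 1.4, case `p = 2` due to Monsky 1996), for an
elliptic `W` and `d ≠ 0` the corank `r_{2^∞}(E^d)` is even iff `w(E^d) = +1` (the twist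
`E^d = W.quadraticTwist d` is elliptic, `isElliptic_quadraticTwist`).
[cite: arXiv250317619, §1 display (1.2)] [cite: DokchitserDokchitserAnnals2010, Thm. 1.4] -/
theorem even_selmerCorankTwoInfty_quadraticTwist_iff_rootNumber
    (hpar : ∀ (E : WeierstrassCurve ℚ) [E.IsElliptic], p_parity E 2) {d : ℤ} (hd : d ≠ 0) :
    Even (selmerCorankTwoInfty (W.quadraticTwist d)) ↔ (W.quadraticTwist d).rootNumber = 1 := by
  haveI := W.isElliptic_quadraticTwist (d := (d : ℚ)) (by exact_mod_cast hd)
  have h2 : (-1 : ℤ) ^ (W.quadraticTwist (d : ℚ)).selmerCorank 2 =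
      (W.quadraticTwist (d : ℚ)).rootNumber := hpar _
  rw [selmerCorankTwoInfty_eq, ← h2, neg_one_pow_eq_one_iff_even (by norm_num)]

/-- Under `2`-parity for all elliptic curves over `ℚ` (`hpar`), for an elliptic `W` the density
statements "`r_{2^∞}(E^d)` is even" and "`w(E^d) = +1`" over squarefree `d` are interchangeable
(the predicates agree for every `d ≠ 0`,
`even_selmerCorankTwoInfty_quadraticTwist_iff_rootNumber`).
[cite: arXiv250317619, §1 display (1.2)] [cite: DokchitserDokchitserAnnals2010, Thm. 1.4] -/
theorem twistDensity_even_selmerCorankTwoInfty_iff_rootNumber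
    (hpar : ∀ (E : WeierstrassCurve ℚ) [E.IsElliptic], p_parity E 2) (δ : ℝ) :
    twistDensity (fun d ↦ d ≠ 0 ∧ Even (selmerCorankTwoInfty (W.quadraticTwist d))) δ ↔
      twistDensity (fun d ↦ d ≠ 0 ∧ (W.quadraticTwist d).rootNumber = 1) δ :=
  twistDensity_congr (fun _ _ ↦ and_congr_right fun hd ↦
    even_selmerCorankTwoInfty_quadraticTwist_iff_rootNumber W hpar hd) δ

/-- **Thm. 1.1 and (1.2) ⇒ the root number is equidistributed in the quadratic twist family**
(A. Smith, arXiv:2503.17619, Thm. 1.1 with display (1.2)): for an elliptic `W`, granted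
`2`-parity for all elliptic curves over `ℚ`, `smith_selmerCorank_density W` implies that the
squarefree `d` with `w(E^d) = +1` have density `1/2`.
[cite: arXiv250317619, Thm. 1.1 and §1 display (1.2)] [cite: DokchitserDokchitserAnnals2010, Thm. 1.4] -/
theorem twistDensity_rootNumber_quadraticTwist_of
    (hpar : ∀ (E : WeierstrassCurve ℚ) [E.IsElliptic], p_parity E 2)
    (hS : smith_selmerCorank_density W) :
    twistDensity (fun d ↦ d ≠ 0 ∧ (W.quadraticTwist d).rootNumber = 1) (1 / 2) :=
  (twistDensity_even_selmerCorankTwoInfty_iff_rootNumber W hpar _).1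
    (twistDensity_even_selmerCorankTwoInfty_of W hS)

/-- **bsd.S34 reduced to its two inputs, parity in root-number form** (A. Smith,
arXiv:2503.17619, Thm. 1.1 with display (1.2)): for an elliptic `W`, granted the `2`-parity
theorem for all elliptic curves over `ℚ` (`hpar` = bsd.S19 at `p = 2`; Dokchitser–Dokchitser
2010, Thm. 1.4 / Monsky 1996), `smith_selmerCorank_density W` holds if and only if
(a) `r_{2^∞}(E^d) ≤ 1` for a density-`1` set of squarefree `d` and (c) the root number `w(E^d)`
is `+1` for a density-`1/2` set of squarefree `d` (both signs of `d` counted, as everywhere in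
bsd.S34). [cite: arXiv250317619, Thm. 1.1 and §1 display (1.2)] [cite: DokchitserDokchitserAnnals2010, Thm. 1.4] -/
theorem smith_selmerCorank_density_iff_le_one_and_rootNumber
    (hpar : ∀ (E : WeierstrassCurve ℚ) [E.IsElliptic], p_parity E 2) :
    smith_selmerCorank_density W ↔
      twistDensity (fun d ↦ d ≠ 0 ∧ selmerCorankTwoInfty (W.quadraticTwist d) ≤ 1) 1 ∧
        twistDensity (fun d ↦ d ≠ 0 ∧ (W.quadraticTwist d).rootNumber = 1) (1 / 2) := by
  rw [smith_selmerCorank_density_iff_le_one_and_even,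
    twistDensity_even_selmerCorankTwoInfty_iff_rootNumber W hpar]

/-- **Sufficiency, root-number form** (A. Smith, arXiv:2503.17619, Thm. 1.1 with (1.2)): for an
elliptic `W`, `2`-parity for all elliptic curves over `ℚ`, "`r_{2^∞}(E^d) ≤ 1` for `100 %`" and
"`w(E^d) = +1` for `50 %`" together give `smith_selmerCorank_density W`.
[cite: arXiv250317619, Thm. 1.1 and §1 display (1.2)] [cite: DokchitserDokchitserAnnals2010, Thm. 1.4] -/
theorem smith_selmerCorank_density_of_le_one_of_rootNumber
    (hpar : ∀ (E : WeierstrassCurve ℚ) [E.IsElliptic], p_parity E 2)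
    (h₁ : twistDensity (fun d ↦ d ≠ 0 ∧ selmerCorankTwoInfty (W.quadraticTwist d) ≤ 1) 1)
    (h₃ : twistDensity (fun d ↦ d ≠ 0 ∧ (W.quadraticTwist d).rootNumber = 1) (1 / 2)) :
    smith_selmerCorank_density W :=
  (smith_selmerCorank_density_iff_le_one_and_rootNumber W hpar).2 ⟨h₁, h₃⟩

/-- **bsd.S34 reduced to its inputs, with `2`-parity taken from its sources in the tree**: as
`smith_selmerCorank_density_iff_le_one_and_rootNumber`, with `hpar` replaced by Monsky's
congruence `corank_{ℤ_2} Sel_{2^∞}(E'/ℚ) ≡ ord_{s=1} L(E', s) (mod 2)`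
(`hMon : monsky_selmerCorank_two_mod_two_eq`; Dokchitser–Dokchitser 2010, §4.6, case `p = 2` of
Thm. 4.19, citing Monsky 1996) and the Modularity Theorem (`hmod`, BCDT 2001, Thm. A), combined
by `p_parity_of_selmerCorank_mod_two_eq_of_exists_isNewformOf` (`BSDSelmerParityProofs`). So,
up to proved theorems, Smith's Thm. 1.1 for `W` is: modularity + Monsky + "corank `≤ 1` for
`100 %`" + "root number `+1` for `50 %`". [cite: arXiv250317619, Thm. 1.1 and §1 display (1.2)]
[cite: DokchitserDokchitserAnnals2010, §4.6, proof of Thm. 4.19 (case p = 2)]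
[cite: BCDTJAMS2001, Thm. A] -/
theorem smith_selmerCorank_density_iff_le_one_and_rootNumber_of_exists_isNewformOf
    (hmod : Literature.NumberTheory.EllipticCurves.ModularForms.exists_isNewformOf)
    (hMon : monsky_selmerCorank_two_mod_two_eq) :
    smith_selmerCorank_density W ↔
      twistDensity (fun d ↦ d ≠ 0 ∧ selmerCorankTwoInfty (W.quadraticTwist d) ≤ 1) 1 ∧
        twistDensity (fun d ↦ d ≠ 0 ∧ (W.quadraticTwist d).rootNumber = 1) (1 / 2) :=
  smith_selmerCorank_density_iff_le_one_and_rootNumber W fun E _ ↦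
    p_parity_of_selmerCorank_mod_two_eq_of_exists_isNewformOf E 2 hmod (hMon.apply E)

/-! ### Cor. 1.2: BSD in the quadratic twist family ⇒ Goldfeld's conjecture for `E` -/

/-- **On the density-`1` set of Thm. 1.1, BSD and (1.2) force `r_an(E^d) = r_{2^∞}(E^d)`**
(A. Smith, arXiv:2503.17619, proof of Cor. 1.2): for an elliptic `W` and `d ≠ 0`, if the rank
part of BSD holds for `E^d` (`(W.quadraticTwist d).BSDRankFormula`, i.e. `r_an(E^d) = r_MW(E^d)`)
and `r_{2^∞}(E^d) ≡ r_an(E^d) (mod 2)` (display (1.2), "[Monsky96]"; here from the closed tree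
fact `hMon : monsky_selmerCorank_two_mod_two_eq` applied to the elliptic curve `E^d`), then
`r_{2^∞}(E^d) ≤ 1` implies `r_an(E^d) = r_{2^∞}(E^d)`: by (1.1), `r_an = r_MW ≤ r_{2^∞} ≤ 1`, and
the two have the same parity. [cite: arXiv250317619, Cor. 1.2 (proof)] [cite: DokchitserDokchitserAnnals2010, §4.6, proof of Thm. 4.19 (case p = 2)] -/
theorem analyticRank_quadraticTwist_eq_selmerCorankTwoInfty_of_le_one
    (hMon : monsky_selmerCorank_two_mod_two_eq) {d : ℤ} (hd : d ≠ 0)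
    (hBSD : (W.quadraticTwist d).BSDRankFormula)
    (hc : selmerCorankTwoInfty (W.quadraticTwist d) ≤ 1) :
    (W.quadraticTwist d).analyticRank = selmerCorankTwoInfty (W.quadraticTwist d) := by
  haveI := W.isElliptic_quadraticTwist (d := (d : ℚ)) (by exact_mod_cast hd)
  have hB : (W.quadraticTwist (d : ℚ)).analyticRank = (W.quadraticTwist (d : ℚ)).mordellWeilRank :=
    hBSD
  have hle : (W.quadraticTwist (d : ℚ)).analyticRank ≤ selmerCorankTwoInfty (W.quadraticTwist d) :=
    hB ▸ mordellWeilRank_quadraticTwist_le_selmerCorankTwoInfty W hd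
  have hpar : (W.quadraticTwist (d : ℚ)).selmerCorank 2 % 2 =
      (W.quadraticTwist (d : ℚ)).analyticRank % 2 := hMon.apply _
  rw [← selmerCorankTwoInfty_eq] at hpar
  omega

/-- **Smith, arXiv:2503.17619, Cor. 1.2, deduced as printed: BSD in the quadratic twist family of
`E` implies Goldfeld's conjecture for `E`.** For an elliptic `W`: if Thm. 1.1 holds for `W`
(`hS : smith_selmerCorank_density W`), the rank part of the BSD conjecture holds for every twist
`E^d`, `d ≠ 0` (`hBSD`, "if the BSD conjecture is true in the quadratic twist family of `E`";
the tree's predicate `WeierstrassCurve.BSDRankFormula`, `r_an = r_MW`), and display (1.2)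
`(-1)^{r_{2^∞}(E')} = (-1)^{r_an(E')}` holds for all elliptic `E'/ℚ` ("From [Monsky96]"; the closed
tree fact `hMon : monsky_selmerCorank_two_mod_two_eq`, Dokchitser–Dokchitser 2010, §4.6), then the
analytic rank `r_an(E^d)` is `0` for density `1/2` of the squarefree `d`, `1` for density `1/2`,
and any fixed `r ≥ 2` for density `0` — Goldfeld's conjecture [Gold79] for `E` in the tree's
density convention (squarefree `d` ordered by `|d|`; the paper's display counts all `d ∈ ℤ^{≠0}`
with `|d| ≤ H` against `2H`, an equivalent normalisation for predicates invariant under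
`d ↦ d m²`, cf. `BSDSelmerSmithNormalisationProofs`). Proof as printed: on the density-`1` set
`{r_{2^∞}(E^d) ≤ 1}` (`twistDensity_selmerCorankTwoInfty_le_one_of`) one has
`r_an(E^d) = r_{2^∞}(E^d)` (`analyticRank_quadraticTwist_eq_selmerCorankTwoInfty_of_le_one`), so
each clause of Thm. 1.1 transfers to `r_an` (`twistDensity_congr_of_one`).
[cite: arXiv250317619, Cor. 1.2] [cite: DokchitserDokchitserAnnals2010, §4.6, proof of Thm. 4.19 (case p = 2)] -/
theorem smith_analyticRank_density_of_BSDRankFormula (hS : smith_selmerCorank_density W)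
    (hBSD : ∀ d : ℤ, d ≠ 0 → (W.quadraticTwist d).BSDRankFormula)
    (hMon : monsky_selmerCorank_two_mod_two_eq) :
    twistDensity (fun d ↦ d ≠ 0 ∧ (W.quadraticTwist d).analyticRank = 0) (1 / 2) ∧
      twistDensity (fun d ↦ d ≠ 0 ∧ (W.quadraticTwist d).analyticRank = 1) (1 / 2) ∧
        ∀ r : ℕ, 2 ≤ r →
          twistDensity (fun d ↦ d ≠ 0 ∧ (W.quadraticTwist d).analyticRank = r) 0 := by
  have hR := twistDensity_selmerCorankTwoInfty_le_one_of W hS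
  have key : ∀ r : ℕ, ∀ d : ℤ, Squarefree d →
      (d ≠ 0 ∧ selmerCorankTwoInfty (W.quadraticTwist d) ≤ 1) →
        ((d ≠ 0 ∧ selmerCorankTwoInfty (W.quadraticTwist d) = r) ↔
          (d ≠ 0 ∧ (W.quadraticTwist d).analyticRank = r)) := fun r d _ hRd ↦ by
    rw [analyticRank_quadraticTwist_eq_selmerCorankTwoInfty_of_le_one W hMon hRd.1
      (hBSD d hRd.1) hRd.2]
  obtain ⟨h0, h1, h2⟩ := hS
  exact ⟨(twistDensity_congr_of_one hR (key 0)).1 h0, (twistDensity_congr_of_one hR (key 1)).1 h1,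
    fun r hr ↦ (twistDensity_congr_of_one hR (key r)).1 (h2 r hr)⟩

end S34Parity

end Literature.NumberTheory.EllipticCurves

end
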